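import Summits.CriticalPhenomena.PercolationContinuityZ3.Theorems.SahiMasterFamilyFiveEq
import Summits.CriticalPhenomena.PercolationContinuityZ3.Theorems.SahiMasterFamilyFiveStepLower

/-!
# The order-five step (equality half) for DECREASING events and for group separations

Unit `prim-master-conj` (crux anchor stmt-CriticalPhenomena-4575); companion of `SahiMasterFamilyFiveEq.lean` (increasing events),
`SahiMasterFamilyFiveStepLower.lean` (positivity half, decreasing events) and the complementation transfer
`SahiMasterFamilyLowerTransfer.lean`.  The percolation rows (`|A| = 5`: the `E3GRP`/`E₅` censuses of run/shared/lean/ttrl) are stated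
on group separations `{X ↮ Y}`, decreasing events; the zero-flag acceptance censuses (every exact zero of `E_5` on separation
quintuples is a `Z_5` instance) are in this form.  PROVED here, unconditionally:
* `sahiE_five_ind_eq_zero_iff_of_zeroFlagQuadruple_lower` — for five decreasing events four of which form a zero flag of order `4`
  and `p` in the open cube, `E_5(μ_p; 1_{D_0},…,1_{D_4}) = 0 ↔ D ∈ Z_5`;
* `sahiE_five_groupSep_eq_zero_iff_of_zeroFlagQuadruple` — the same for five group separations of a finite weighted graph (edge
  weights in the open cube; zero-flag class computed on the edge cube).
[this work]
-/

noncomputable section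

set_option autoImplicit false

open scoped Classical
open scoped unitInterval

namespace Summit.CriticalPhenomena.PercolationContinuityZ3.Theorems

open Finset Function MeasureTheory
open Literature.Combinatorics.Sahi2008
open Literature.Probability.LatticeModels (isUpperSet_preimage_compl isLowerSet_preimage_compl)
open Literature.Probability.Percolation.DecisionTree (ind)

section Lower

variable {ι : Type} [Fintype ι]

/-- **(EQ-5) for five decreasing events with a `Z_4` sub-family** (`p` in the open cube): `E_5 = 0 ↔ D ∈ Z_5`. [this work] -/
theorem sahiE_five_ind_eq_zero_iff_of_zeroFlagQuadruple_lower (p : ι → unitInterval)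
    (hp : ∀ e, (p e : ℝ) ∈ Set.Ioo (0 : ℝ) 1) (D : Fin 5 → Set (Set ι)) (hD : ∀ j, IsLowerSet (D j)) (m : Fin 5)
    (hZ : SuppZeroFlag 4 (fun j => D (m.succAbove j))) :
    sahiE (bernoulliWeight p) 5 (fun j => ind (D j)) = 0 ↔ SuppZeroFlag 5 D := by
  rw [sahiE_ind_eq_sahiE_ind_preimage_compl, ← suppZeroFlag_preimage_compl_iff 5 D]
  exact sahiE_five_ind_eq_zero_iff_of_zeroFlagQuadruple _ ((symm_mem_Ioo_iff p).2 hp) (fun j => compl ⁻¹' D j)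
    (fun j => isUpperSet_preimage_compl (hD j)) m
    ((suppZeroFlag_preimage_compl_iff 4 (fun j => D (m.succAbove j))).2 hZ)

/-- **The order-five step for decreasing events, both halves**: `E_5 ≥ 0` (every `p`) and, in the open cube, `E_5 = 0 ↔ D ∈ Z_5`.
[this work] -/
theorem masterFamily_step_five_lower (p : ι → unitInterval) (hp : ∀ e, (p e : ℝ) ∈ Set.Ioo (0 : ℝ) 1)
    (D : Fin 5 → Set (Set ι)) (hD : ∀ j, IsLowerSet (D j)) (m : Fin 5) (hZ : SuppZeroFlag 4 (fun j => D (m.succAbove j))) :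
    0 ≤ sahiE (bernoulliWeight p) 5 (fun j => ind (D j)) ∧
      (sahiE (bernoulliWeight p) 5 (fun j => ind (D j)) = 0 ↔ SuppZeroFlag 5 D) :=
  ⟨sahiE_five_ind_nonneg_of_zeroFlagQuadruple_lower p D hD m hZ,
    sahiE_five_ind_eq_zero_iff_of_zeroFlagQuadruple_lower p hp D hD m hZ⟩

end Lower

/-! ### The graph form: five group separations -/

section Graph

open Literature.Probability.Percolation

variable {V : Type} [Fintype V]

/-- **The equality face for five group separations with a `Z_4` sub-family** (edge weights in the open cube):
`E_5({X_0 ↮ Y_0},…,{X_4 ↮ Y_4}) = 0 ↔` the quintuple lies in `Z_5` (computed on the edge cube). [this work] -/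
theorem sahiE_five_groupSep_eq_zero_iff_of_zeroFlagQuadruple (w : Sym2 V → unitInterval)
    (hw : ∀ e, (w e : ℝ) ∈ Set.Ioo (0 : ℝ) 1) (X Y : Fin 5 → Set V) (m : Fin 5)
    (hZ : SuppZeroFlag 4 fun j =>
      {ω : BondConfig V | ∀ x ∈ X (m.succAbove j), ∀ y ∈ Y (m.succAbove j), ¬ (openGraph ω).Reachable x y}) :
    sahiE (bernoulliWeight w) 5
        (fun j => ind {ω : BondConfig V | ∀ x ∈ X j, ∀ y ∈ Y j, ¬ (openGraph ω).Reachable x y}) = 0 ↔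
      SuppZeroFlag 5 fun j => {ω : BondConfig V | ∀ x ∈ X j, ∀ y ∈ Y j, ¬ (openGraph ω).Reachable x y} :=
  sahiE_five_ind_eq_zero_iff_of_zeroFlagQuadruple_lower w hw
    (fun j => {ω : BondConfig V | ∀ x ∈ X j, ∀ y ∈ Y j, ¬ (openGraph ω).Reachable x y})
    (fun j => isLowerSet_groupSep (X j) (Y j)) m hZ

end Graph

end Summit.CriticalPhenomena.PercolationContinuityZ3.Theorems
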